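import Literature.RingTheory.MvPowerSeries.HasseDerivDiffOp
import Literature.RingTheory.MvPowerSeries.PartialDerivative
import Mathlib.Algebra.CharP.Two
import HarnessLib

/-!
# K-β7-hat W2 (`BranchObstruction`), block α — Hasse-derivative VANISHING along a branch (W4.1, OURS)

First kernel block of the heart W2 of the `FormalCentreDescent` decomposition (res-L0-w41-idea-1
`K7HatWords-idea-1-g12.lean` cbdb8a4f311bfcb9 l.223; memo `CANONICAL-CLEANING-g10.md` §12.3 step (4);
res-L0-w41-plan-1 RULING 237(b): W2 → res-D-pv-036). Pure power-series algebra, no run vocabulary: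

Let `γ : A⟦X⟧ →+* M` be a ring homomorphism into a DOMAIN `M` (in W2: the parametrisation of a second formal
branch, `M = κ′⟦τ⟧`), `P ⊆ ker γ` an ideal, and suppose (characteristic `2`) `u² F + r² ∈ P^d` with `γ u ≠ 0`
(the square-descent datum transported to the branch). Then **every divided (Hasse) derivative of order
`≤ d − 2` of `∂F/∂X_i` dies under `γ`**: `γ (Δ_α (∂_i F)) = 0` for `|α| ≤ d − 2` (`map_hasseDeriv_pd_eq_zero`).

Route: `∂_i` kills squares in characteristic 2, so `∂_i (u² F + r²) = u²·∂_i F ∈ P^{d−1}`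
(`IsDiffOpLE.apply_mem_pow_sub`, `∂_i = Δ_{e_i}` has order `≤ 1`); `Δ_α (P^{d−1}) ⊆ P^{d−1−|α|} ⊆ P ⊆ ker γ`
for `|α| ≤ d − 2`; the higher Leibniz rule `Δ_α (u² G) = Σ_{β+β′=α} Δ_β u² · Δ_{β′} G` (tree
`hasseDeriv_mul`) under `γ` is a triangular system with invertible diagonal `γ(u)² ≠ 0` in the domain `M`, so
`γ (Δ_α G) = 0` by induction on `|α|` (`eq_zero_of_antidiagonal_sum_eq_zero`).

Everything here is OURS (the run's own bookkeeping), AI-written and AI-checked only — weaker than expert review;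
nothing is a statement of [Hironaka2017]. -/

set_option linter.dupNamespace false
set_option autoImplicit false

namespace Summit.ResolutionOfSingularities.ResolutionOfSingularities.Theorems.SwitchingDichotomy.BranchHasse

open Finset
open Literature.RingTheory.MvPowerSeries (hasseDeriv hasseDeriv_mul hasseDeriv_zero pd pd_mul pd_pow_succ
  hasseDeriv_single_eq_pd isDiffOpLE_hasseDeriv)
open Literature.AlgebraicGeometry.Resolution (IsDiffOpLE)

/-- **Triangular induction**: if `Σ_{β+β′=α} a β · b β′ = 0` for all exponents `α` of degree `≤ N`, with
`a 0` a non-zero element of a domain, then `b α = 0` for all `α` of degree `≤ N`. OURS. -/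
theorem eq_zero_of_antidiagonal_sum_eq_zero {σ M : Type*} [DecidableEq σ] [CommRing M] [NoZeroDivisors M]
    (a b : (σ →₀ ℕ) → M) (ha : a 0 ≠ 0) (N : ℕ)
    (h : ∀ α : σ →₀ ℕ, α.degree ≤ N → ∑ p ∈ antidiagonal α, a p.1 * b p.2 = 0) :
    ∀ α : σ →₀ ℕ, α.degree ≤ N → b α = 0 := by
  intro α
  induction' hn : α.degree using Nat.strong_induction_on with n ih generalizing α
  intro hαN
  have hsum := h α (by omega)
  have hmem : ((0 : σ →₀ ℕ), α) ∈ antidiagonal α := by simp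
  rw [Finset.sum_eq_single_of_mem _ hmem] at hsum
  · exact (mul_eq_zero.mp hsum).resolve_left ha
  · rintro ⟨β, β'⟩ hp hne
    rw [HasAntidiagonal.mem_antidiagonal] at hp
    have hβ : β ≠ 0 := by
      rintro rfl
      apply hne
      simp only [zero_add] at hp
      rw [hp]
    have hdeg : β'.degree < n := by
      have h1 : β.degree + β'.degree = n := by rw [← map_add, hp, hn]
      have h2 : β.degree ≠ 0 := fun h0 => hβ ((Finsupp.degree_eq_zero_iff β).mp h0)
      omega
    rw [ih β'.degree hdeg β' rfl (by omega), mul_zero]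

variable {τ : Type*} [Fintype τ] [DecidableEq τ] {A M : Type*} [CommRing A] [CommRing M] [IsDomain M]

/-- **Vanishing of Hasse derivatives under `γ` descends along a factor with `γ u ≠ 0`**: if
`γ (Δ_α (u · g)) = 0` for all `|α| ≤ N` and `γ u ≠ 0` (`M` a domain), then `γ (Δ_α g) = 0` for all `|α| ≤ N`
(higher Leibniz rule + triangular induction). OURS. -/
theorem map_hasseDeriv_eq_zero_of_mul (γ : MvPowerSeries τ A →+* M) (u g : MvPowerSeries τ A)
    (hu : γ u ≠ 0) (N : ℕ) (h : ∀ α : τ →₀ ℕ, α.degree ≤ N → γ (hasseDeriv α (u * g)) = 0) :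
    ∀ α : τ →₀ ℕ, α.degree ≤ N → γ (hasseDeriv α g) = 0 := by
  refine eq_zero_of_antidiagonal_sum_eq_zero (fun β => γ (hasseDeriv β u)) (fun β => γ (hasseDeriv β g))
    (by rwa [hasseDeriv_zero]) N fun α hα => ?_
  have hh := h α hα
  rw [hasseDeriv_mul, map_sum] at hh
  rw [← hh]
  refine Finset.sum_congr rfl fun p _ => ?_
  rw [map_mul]

/-- In characteristic `2` the partial derivative of `u² F + r²` is `u² · ∂_i F`. OURS. -/
theorem pd_sq_mul_add_sq [CharP A 2] (i : τ) (u F r : MvPowerSeries τ A) :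
    pd i (u ^ 2 * F + r ^ 2) = u ^ 2 * pd i F := by
  have hsq : ∀ f : MvPowerSeries τ A, pd i (f ^ 2) = 0 := by
    intro f
    rw [show (2 : ℕ) = 1 + 1 from rfl, pd_pow_succ]
    have : ((1 + 1 : ℕ) : MvPowerSeries τ A) = 0 := by
      rw [← map_natCast (MvPowerSeries.C (σ := τ) (R := A)), CharP.cast_eq_zero, map_zero]
    rw [this, zero_mul, zero_mul]
  rw [map_add, pd_mul, hsq u, hsq r, zero_mul, zero_add, add_zero]

/-- A Hasse derivative of order `≤ n` maps `P^m` into `P^{m−n}` (tree `IsDiffOpLE.apply_mem_pow_sub` +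
`isDiffOpLE_hasseDeriv`). OURS packaging. -/
theorem hasseDeriv_mem_pow_sub (P : Ideal (MvPowerSeries τ A)) (m : ℕ) (α : τ →₀ ℕ)
    {f : MvPowerSeries τ A} (hf : f ∈ P ^ m) : hasseDeriv α f ∈ P ^ (m - α.degree) :=
  IsDiffOpLE.apply_mem_pow_sub P m (isDiffOpLE_hasseDeriv (A := A) α.degree α le_rfl) hf

/-- The partial derivative maps `P^m` into `P^{m−1}`. OURS packaging. -/
theorem pd_mem_pow_sub (P : Ideal (MvPowerSeries τ A)) (m : ℕ) (i : τ)
    {f : MvPowerSeries τ A} (hf : f ∈ P ^ m) : pd i f ∈ P ^ (m - 1) := by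
  have h := hasseDeriv_mem_pow_sub P m (Finsupp.single i 1) hf
  rwa [hasseDeriv_single_eq_pd, Finsupp.degree_single] at h

/-- **Hasse derivatives of `∂_i F` die along a branch carrying the square-descent datum** (memo §12.3 (4),
first half). `γ : A⟦X⟧ →+* M` into a domain, `P ≤ ker γ`, characteristic `2`, `u² F + r² ∈ P^d`, `γ u ≠ 0`:
then `γ (Δ_α (∂_i F)) = 0` for every `α` with `|α| ≤ d − 2`. OURS. -/
theorem map_hasseDeriv_pd_eq_zero [CharP A 2] (γ : MvPowerSeries τ A →+* M) (P : Ideal (MvPowerSeries τ A))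
    (hP : ∀ f ∈ P, γ f = 0) {d : ℕ} (hd : 2 ≤ d) (u F r : MvPowerSeries τ A) (hu : γ u ≠ 0)
    (hE : u ^ 2 * F + r ^ 2 ∈ P ^ d) (i : τ) :
    ∀ α : τ →₀ ℕ, α.degree ≤ d - 2 → γ (hasseDeriv α (pd i F)) = 0 := by
  have hE' : u ^ 2 * pd i F ∈ P ^ (d - 1) := by
    rw [← pd_sq_mul_add_sq]
    exact pd_mem_pow_sub P d i hE
  refine map_hasseDeriv_eq_zero_of_mul γ (u ^ 2) (pd i F) (by rw [map_pow]; exact pow_ne_zero 2 hu)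
    (d - 2) fun α hα => ?_
  apply hP
  have hmem := hasseDeriv_mem_pow_sub P (d - 1) α hE'
  have hle : 1 ≤ d - 1 - α.degree := by omega
  exact Ideal.pow_le_self (by omega) (Ideal.pow_le_pow_right hle hmem)

end Summit.ResolutionOfSingularities.ResolutionOfSingularities.Theorems.SwitchingDichotomy.BranchHasse
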